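/-
Copyright (c) 2026 the pub-hodgecm-mathlib formalisation cell (harness21).  Prover seat hodgecm-mathlib-K2E4-p14 (g9), Track B ∕ K2-LIT, h413 = `stmt-HodgeConjecture-24833`,
line `K2_E1_TraceFormulaBeta`, campaign 5Res (ROADCARD §3′ M2 v2), deals (246)∕(248)∕(249) of the dealer K2E1-plan (g7) («B1 → B2»): FILE B2 — the bracket bridge to the MODEL
currency: for a SELF-DUAL unitary `χ` the raw idele-class brackets of ★∕B1 are `κ · ⟪·,·⟫_{L²(K_U)}` on the `L²(K_U)`-classes of `φ` and of the intertwined coefficients, i.e. the `hrel`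
letter of ★ `poleControl_continued_chi_cm_two_of_family_selfDual_on` :133 with `V := L²(K_U, μ_K)`, `κ := ∫_{𝓕_I∩{‖x‖≤1}} ‖x‖ dν_I`, `m := 1`.
-/
import Summits.HodgeConjecture.HodgeConjecture.Theorems.K2E1ChiMaassSelbergPairingFamilyCMTwo   -- ★ p860535 (this seat) B1: `inner_truncatedFamily_eq_fourTerm_chi_cm_two`
import Summits.HodgeConjecture.HodgeConjecture.Theorems.K2E1ChiSectionPlancherelKTypeCMTwo      -- ★ (K2E4-p10): `inner_eq_integral_mul_conj` (the `L²(K)`-pairing as an inner product)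
import HarnessLib

/-!
# K2·E1 — `K2E1ChiMaassSelbergPairingModelCMTwo` (5Res, bracket bridge FILE B2): `⟪F′ z′, F z⟫ = cμ·K·R(z, z′; κ·⟪·,·⟫_{L²(K_U)})` — the χ-Maass–Selberg relation of a SELF-DUAL
# family of `U(1,1)_{L∕L⁺}` in the MODEL currency of ★ `…ContinuedModelsCMTwo` :133 (`V = L²(K_U)`, `m = 1`)

Track B ∕ K2-LIT, crux h413 = `stmt-HodgeConjecture-24833`, route of record `HCCMUnconditional`; cell `hodgecm-mathlib`, squad K2, ENGINE E1 (5Res, the (d)-realness ∕ `hs` road at M1;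
consumer = K2E1-p13 (g3)'s assembly `K2E1ChiScatteringRealPolesM1CMTwo`).  THEOREMS ONLY (no `def`, no `instance`, no notation, no named-fact hypothesis, no `sorry`); lane
`--supports stmt-HodgeConjecture-24833 --as helper` (count-neutral).  Closes no socket.

WHAT.  ★ B1 `inner_truncatedFamily_eq_fourTerm_chi_cm_two` gives `⟪F′ z′, F z⟫ = cμ·K·(four-term)` with the RAW brackets of ★ `maassSelberg_chiSection_cm_two_self`: brackets 1 and 4 are
`(∫_S ‖x‖ dν_I) · ⟨·,·⟩_K`, brackets 2 and 3 carry the idele-class densities `χ·conj χʷ`, `χʷ·conj χ` (`χʷ = reflectChar c χ`).  For a SELF-DUAL `χ` (`χʷ = χ`) and `χ` unitary these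
densities are `≡ 1` (`|χ(x)| = 1`), so every bracket is `κ · ⟨α, β⟩_K`, `κ := ∫_{𝓕_I ∩ {‖x‖≤1}} ‖x‖ dν_I` REAL; and the `K_U`-pairing `⟨α, β⟩_K = ∫_K α conj β dμ_K` is the `L²(K_U, μ_K)` inner
product `⟪β̂, α̂⟫` of any `L²`-classes `α̂ =ᵐ α|_K`, `β̂ =ᵐ β|_K` (★ K2E4-p10 `inner_eq_integral_mul_conj`).  Hence, for classes `φK, φK′` of `φ, φ′` and maps `ψ, ψ′ : ℂ → L²(K_U)` agreeing
a.e. with the intertwined coefficients `φ̃_z, φ̃′_{z′}` on the tube, `⟪F′ z′, F z⟫ = cμ·K·( T^{s₁}∕s₁·κ·1·⟪φK′, φK⟫ + T^{s₂}∕s₂·κ·1·⟪ψ′ z′, φK⟫ − T^{−s₂}∕s₂·κ·1·⟪φK′, ψ z⟫ − T^{−s₁}∕s₁·κ·1·⟪ψ′ z′, ψ z⟫ )`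
— EXACTLY the `hrel` bytes of ★ :133 with `V := Lp ℂ 2 μK`, `φ := φK`, `ψ`, `m := 1` (instantiate `F′ = F`, `φ′ = φ`, `ψ′ = ψ`).  The continuation of `ψ` off the tube (from ★ M1 PRINT
p860338's scattering coordinates `qc_j`, `bV_j`) and `hdec′` (K2E4-p10 (b)) stay with the assembly.
* §1 `coe_mul_conj_coe_eq_one` (unitary: `χ(x)·conj χ(x) = 1`; with `χʷ = χ` both cross densities are `1`).
* §2 HEAD **`inner_truncatedFamily_eq_fourTerm_chi_model_cm_two`**.
HONEST LABEL: HC_CM is proved only modulo the 7 printed citations (2 remaining named inputs: hLiu418 = `stmt-HodgeConjecture-24832`, h413 = `stmt-HodgeConjecture-24833`) until rung 0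
closes; this file asserts no named fact and closes no socket; count-neutral; CONDITIONAL on `hdec′` (visible) and on the classes∕families it is fed.

## References
* [MoeglinWaldspurger1995] C. Mœglin, J.-L. Waldspurger, *Spectral decomposition and Eisenstein series* (1995), II.1.7, IV.2.3, IV.3.12 (a).
* [Arthur1980TraceFormulaII] J. Arthur, *A trace formula for reductive groups II*, Compositio Math. 40 (1980), §4.
-/

set_option autoImplicit false
-- the mandated namespace repeats `HodgeConjecture.HodgeConjecture`, as in every `Theorems/*.lean` of this sub-problem
set_option linter.dupNamespace false

noncomputable section

open MeasureTheory MeasureTheory.Measure Set NumberField IsDedekindDomain Filter Topology Metric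
open scoped NNReal ENNReal ComplexConjugate InnerProductSpace
open Literature.MeasureTheory.Group Literature.NumberTheory
open Literature.NumberTheory.Automorphic Literature.NumberTheory.Automorphic.UnitaryGroup AdelicGroupData
open Literature.NumberTheory.GaloisRepresentations
open Summit.HodgeConjecture.HodgeConjecture.Cruxes.H413.K2E1BorelEisensteinU
open Summit.HodgeConjecture.HodgeConjecture.Cruxes.H413.K2E1CharacterEisensteinU2Defs
open Summit.HodgeConjecture.HodgeConjecture.Cruxes.H413.K2E1ChiMaassSelbergPairingFamilyCMTwo (inner_truncatedFamily_eq_fourTerm_chi_cm_two)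
open Summit.HodgeConjecture.HodgeConjecture.Cruxes.H413.K2E1ChiSectionPlancherelKTypeCMTwo (inner_eq_integral_mul_conj)

namespace Summit.HodgeConjecture.HodgeConjecture.Cruxes.H413.K2E1ChiMaassSelbergPairingModelCMTwo

/-! ## §1 Self-dual unitary characters have trivial cross densities; constants out of the idele-class integral -/

section Density

variable {L : Type} [Field L] [NumberField L]

/-- For a UNITARY Hecke character, `χ(x)·conj χ(x) = 1`. [folklore] -/
theorem coe_mul_conj_coe_eq_one {χ : HeckeCharacter L} (hχ : χ.IsUnitary) (x : (AdeleRing (𝓞 L) L)ˣ) : ((χ x : ℂˣ) : ℂ) * conj ((χ x : ℂˣ) : ℂ) = 1 := by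
  rw [Complex.mul_conj, Complex.normSq_eq_norm_sq, hχ x]
  simp

end Density

/-! ## §2 HEAD: the χ-Maass–Selberg relation of a self-dual family in the model currency -/

section Family

variable (L : Type) [Field L] [NumberField L] [IsCMField L]
variable [MeasurableSpace (quasiSplit (↥(maximalRealSubfield L)) L (IsCMField.complexConj L) 2).Adelic] [BorelSpace (quasiSplit (↥(maximalRealSubfield L)) L (IsCMField.complexConj L) 2).Adelic]
variable [MeasurableSpace (AdeleRing (𝓞 L) L)ˣ] [BorelSpace (AdeleRing (𝓞 L) L)ˣ]

/-- **`⟪F′ z′, F z⟫ = cμ·K·R(z, z′; κ·1·⟪·,·⟫_{L²(K_U)})` FOR A SELF-DUAL FAMILY** (module docstring): B1's binders + `hsd : reflectChar c χ = χ` + `L²(K_U)`-classes `φK =ᵐ φ|_K`, `φK′ =ᵐ φ′|_K`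
and maps `ψ, ψ′ : ℂ → L²(K_U)` with `ψ z =ᵐ φ̃_z|_K`, `ψ′ z′ =ᵐ φ̃′_{z′}|_K` on the tube ⟹ the `hrel` bytes of ★ :133 with `V := Lp ℂ 2 μK`, `κ := ∫_{𝓕_I∩{‖x‖≤1}} ‖x‖ dν_I`, `m := 1`.
[cite: MoeglinWaldspurger1995, II.1.7 and IV.2.3] [cite: Arthur1980TraceFormulaII, §4] -/
theorem inner_truncatedFamily_eq_fourTerm_chi_model_cm_two
    (μ : Measure (quasiSplit (↥(maximalRealSubfield L)) L (IsCMField.complexConj L) 2).automorphicQuotient) [(quasiSplit (↥(maximalRealSubfield L)) L (IsCMField.complexConj L) 2).IsAutomorphicMeasure μ]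
    (νG : Measure (quasiSplit (↥(maximalRealSubfield L)) L (IsCMField.complexConj L) 2).Adelic) [νG.IsHaarMeasure] [νG.IsInvInvariant]
    (μK : Measure ((standardMaximalCompactGL 2 L).comap (adelicVal (↥(maximalRealSubfield L)) L (IsCMField.complexConj L) 2 ((StdForm.antidiagonal 2).over L)) : Subgroup (quasiSplit (↥(maximalRealSubfield L)) L (IsCMField.complexConj L) 2).Adelic))
    [μK.IsHaarMeasure]
    (νI : Measure (AdeleRing (𝓞 L) L)ˣ) [νI.IsHaarMeasure]
    {𝓕I : Set (AdeleRing (𝓞 L) L)ˣ} (h𝓕I : IsIdeleClassDomain L 𝓕I)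
    (ν : Measure ↥(adelicUnipotent (↥(maximalRealSubfield L)) L (IsCMField.complexConj L) 2)) [ν.IsHaarMeasure]
    {𝓕 : Set ↥(adelicUnipotent (↥(maximalRealSubfield L)) L (IsCMField.complexConj L) 2)} (h𝓕N : IsFundamentalDomain ↥(rationalUnipotent (↥(maximalRealSubfield L)) L (IsCMField.complexConj L) 2) 𝓕 ν) (h𝓕1 : ν 𝓕 = 1)
    (h𝓕c : IsCompact (closure 𝓕))
    {β : (quasiSplit (↥(maximalRealSubfield L)) L (IsCMField.complexConj L) 2).Adelic → ℝ≥0∞} (hβ : IsCoveringWeight ((arithmeticBorel (↥(maximalRealSubfield L)) L (IsCMField.complexConj L) 2).map (quasiSplit (↥(maximalRealSubfield L)) L (IsCMField.complexConj L) 2).arithmeticSubgroup.subtype) β)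
    {T : ℝ≥0} (hT : 1 ≤ T)
    {χ : HeckeCharacter L} (hχ : χ.IsUnitary) (hρ : ∀ r : ℝ≥0ˣ, χ (posRealIdele L r) = 1)
    {φ φ' : (quasiSplit (↥(maximalRealSubfield L)) L (IsCMField.complexConj L) 2).Adelic → ℂ}
    (hφc : Continuous φ) (hφ : IsChiSection χ φ) {Cφ : ℝ} (hφC : ∀ x, ‖φ x‖ ≤ Cφ)
    (hφ'c : Continuous φ') (hφ' : IsChiSection χ φ') {Cφ' : ℝ} (hφ'C : ∀ x, ‖φ' x‖ ≤ Cφ')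
    -- the survivor `hdec′` of ★ :232, at every point of the tube (payer at M1: K2E4-p10 (b), ★ `K2E1HeightLineArchSmoothU2` :233)
    (hdec' : ∀ z' : ℂ, 1 < z'.re → ∃ M₁ : ℝ, ∀ g : (quasiSplit (↥(maximalRealSubfield L)) L (IsCMField.complexConj L) 2).Adelic, T < borelHeight g →
      ‖eisensteinSeriesU (flatSectionU φ' z') g - borelConstantTerm ν 𝓕 (eisensteinSeriesU (flatSectionU φ' z')) g‖ ≤ M₁)
    -- the operator road's families on `D₁` with their tube identities (★ closer₂-χ)
    {D₁ : Set ℂ} (F F' : ℂ → Lp ℂ 2 μ)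
    (hFtube : ∀ z ∈ D₁, 1 < z.re → ((F z : Lp ℂ 2 μ) : (quasiSplit (↥(maximalRealSubfield L)) L (IsCMField.complexConj L) 2).automorphicQuotient → ℂ) =ᵐ[μ] (quasiSplit (↥(maximalRealSubfield L)) L (IsCMField.complexConj L) 2).quotFun (truncation ν 𝓕 T (eisensteinSeriesU (flatSectionU φ z))))
    (hF'tube : ∀ z' ∈ D₁, 1 < z'.re → ((F' z' : Lp ℂ 2 μ) : (quasiSplit (↥(maximalRealSubfield L)) L (IsCMField.complexConj L) 2).automorphicQuotient → ℂ) =ᵐ[μ] (quasiSplit (↥(maximalRealSubfield L)) L (IsCMField.complexConj L) 2).quotFun (truncation ν 𝓕 T (eisensteinSeriesU (flatSectionU φ' z'))))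
    -- self-duality and the `L²(K_U)` model data
    (hsd : reflectChar (IsCMField.complexConj L) χ = χ)
    (φK φK' : Lp ℂ 2 μK) (hφK : ((φK : Lp ℂ 2 μK) : _ → ℂ) =ᵐ[μK] fun k => φ (k : (quasiSplit (↥(maximalRealSubfield L)) L (IsCMField.complexConj L) 2).Adelic)) (hφK' : ((φK' : Lp ℂ 2 μK) : _ → ℂ) =ᵐ[μK] fun k => φ' (k : (quasiSplit (↥(maximalRealSubfield L)) L (IsCMField.complexConj L) 2).Adelic))
    (ψ ψ' : ℂ → Lp ℂ 2 μK)
    (hψ : ∀ z ∈ D₁, 1 < z.re → ((ψ z : Lp ℂ 2 μK) : _ → ℂ) =ᵐ[μK] fun k => (fun g : (quasiSplit (↥(maximalRealSubfield L)) L (IsCMField.complexConj L) 2).Adelic => (∫ v : ↥(adelicUnipotent (↥(maximalRealSubfield L)) L (IsCMField.complexConj L) 2), flatSectionU φ z ((quasiSplit (↥(maximalRealSubfield L)) L (IsCMField.complexConj L) 2).toAdelic (weylLongU ((IsCMField.complexConj L : L ≃ₐ[↥(maximalRealSubfield L)] L) : L →+* L) (rfl : (StdForm.antidiagonal 2).over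 L = (StdForm.antidiagonal 2).over L)) * ((v : (quasiSplit (↥(maximalRealSubfield L)) L (IsCMField.complexConj L) 2).Adelic) * g)) ∂ν) * ((borelHeight g : ℝ) : ℂ) ^ (z - 1)) (k : (quasiSplit (↥(maximalRealSubfield L)) L (IsCMField.complexConj L) 2).Adelic))
    (hψ' : ∀ z' ∈ D₁, 1 < z'.re → ((ψ' z' : Lp ℂ 2 μK) : _ → ℂ) =ᵐ[μK] fun k => (fun g : (quasiSplit (↥(maximalRealSubfield L)) L (IsCMField.complexConj L) 2).Adelic => (∫ v : ↥(adelicUnipotent (↥(maximalRealSubfield L)) L (IsCMField.complexConj L) 2), flatSectionU φ' z' ((quasiSplit (↥(maximalRealSubfield L)) L (IsCMField.complexConj L) 2).toAdelic (weylLongU ((IsCMField.complexConj L : L ≃ₐ[↥(maximalRealSubfield L)] L) : L →+* L) (rfl : (StdForm.antidiagonal 2).over L = (StdForm.antidiagonal 2).over L)) * ((v : (quasiSplit (↥(maximalRealSubfield L)) L (IsCMField.complexConj L) 2).Adelic) * g)) ∂ν) * ((borelHeight g : ℝ) : ℂ) ^ (z' - 1)) (k : (quasiSplit (↥(maximalRealSubfield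 L)) L (IsCMField.complexConj L) 2).Adelic)) :
    ∃ cμ K : ℝ, 0 < cμ ∧ 0 < K ∧ ∀ z ∈ D₁, ∀ z' ∈ D₁, 1 < z'.re → z'.re < z.re → ⟪F' z', F z⟫_ℂ =
          (cμ : ℂ) * ((K : ℂ) *
            ((((T : ℝ) : ℂ) ^ (z + conj z' - 1) / (z + conj z' - 1)) * ((((∫ x in {x : (AdeleRing (𝓞 L) L)ˣ | (IdeleClassGroup.ideleNorm L x : ℝ) ≤ 1} ∩ 𝓕I, (IdeleClassGroup.ideleNorm L x : ℝ) ∂νI) : ℝ) : ℂ) * (((1 : ℝ) : ℂ) * ⟪φK', φK⟫_ℂ))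
              + (((T : ℝ) : ℂ) ^ (z - conj z') / (z - conj z')) * ((((∫ x in {x : (AdeleRing (𝓞 L) L)ˣ | (IdeleClassGroup.ideleNorm L x : ℝ) ≤ 1} ∩ 𝓕I, (IdeleClassGroup.ideleNorm L x : ℝ) ∂νI) : ℝ) : ℂ) * (((1 : ℝ) : ℂ) * ⟪ψ' z', φK⟫_ℂ))
              - (((T : ℝ) : ℂ) ^ (-(z - conj z')) / (z - conj z')) * ((((∫ x in {x : (AdeleRing (𝓞 L) L)ˣ | (IdeleClassGroup.ideleNorm L x : ℝ) ≤ 1} ∩ 𝓕I, (IdeleClassGroup.ideleNorm L x : ℝ) ∂νI) : ℝ) : ℂ) * (((1 : ℝ) : ℂ) * ⟪φK', ψ z⟫_ℂ))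
              - (((T : ℝ) : ℂ) ^ (-(z + conj z' - 1)) / (z + conj z' - 1)) * ((((∫ x in {x : (AdeleRing (𝓞 L) L)ˣ | (IdeleClassGroup.ideleNorm L x : ℝ) ≤ 1} ∩ 𝓕I, (IdeleClassGroup.ideleNorm L x : ℝ) ∂νI) : ℝ) : ℂ) * (((1 : ℝ) : ℂ) * ⟪ψ' z', ψ z⟫_ℂ)))) := by
  obtain ⟨cμ, K, hcμ, hK, h⟩ := inner_truncatedFamily_eq_fourTerm_chi_cm_two L μ νG μK νI h𝓕I ν h𝓕N h𝓕1 h𝓕c hβ hT hχ hρ hφc hφ hφC hφ'c hφ' hφ'C hdec' F F' hFtube hF'tube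
  refine ⟨cμ, K, hcμ, hK, fun z hz z' hz' h1 h2 => ?_⟩
  rw [h z hz z' hz' h1 h2]
  -- the densities are `1` for a self-dual unitary `χ`
  have hd : ∀ x : (AdeleRing (𝓞 L) L)ˣ, ((χ x : ℂˣ) : ℂ) * conj ((reflectChar (IsCMField.complexConj L) χ x : ℂˣ) : ℂ) = 1 := fun x => by
    rw [hsd]; exact coe_mul_conj_coe_eq_one hχ x
  have hd' : ∀ x : (AdeleRing (𝓞 L) L)ˣ, ((reflectChar (IsCMField.complexConj L) χ x : ℂˣ) : ℂ) * conj ((χ x : ℂˣ) : ℂ) = 1 := fun x => by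
    rw [hsd]; exact coe_mul_conj_coe_eq_one hχ x
  -- the idele-class constant
  have hκ : (∫ x in {x : (AdeleRing (𝓞 L) L)ˣ | (IdeleClassGroup.ideleNorm L x : ℝ) ≤ 1} ∩ 𝓕I, ((IdeleClassGroup.ideleNorm L x : ℝ) : ℂ) ∂νI) = ((((∫ x in {x : (AdeleRing (𝓞 L) L)ˣ | (IdeleClassGroup.ideleNorm L x : ℝ) ≤ 1} ∩ 𝓕I, (IdeleClassGroup.ideleNorm L x : ℝ) ∂νI) : ℝ)) : ℂ) := integral_ofReal
  -- the four `K_U`-pairings as `L²(K_U)` inner products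
  have hP1 : ⟪φK', φK⟫_ℂ = (∫ k, φ (k : (quasiSplit (↥(maximalRealSubfield L)) L (IsCMField.complexConj L) 2).Adelic) * conj (φ' (k : (quasiSplit (↥(maximalRealSubfield L)) L (IsCMField.complexConj L) 2).Adelic)) ∂μK) := inner_eq_integral_mul_conj φK' φK hφK' hφK
  have hP2 : ⟪ψ' z', φK⟫_ℂ = (∫ k, φ (k : (quasiSplit (↥(maximalRealSubfield L)) L (IsCMField.complexConj L) 2).Adelic) * conj ((fun g : (quasiSplit (↥(maximalRealSubfield L)) L (IsCMField.complexConj L) 2).Adelic => (∫ v : ↥(adelicUnipotent (↥(maximalRealSubfield L)) L (IsCMField.complexConj L) 2), flatSectionU φ' z' ((quasiSplit (↥(maximalRealSubfield L)) L (IsCMField.complexConj L) 2).toAdelic (weylLongU ((IsCMField.complexConj L : L ≃ₐ[↥(maximalRealSubfield L)] L) : L →+* L) (rfl : (StdForm.antidiagonal 2).over L = (StdForm.antidiagonal 2).over L)) * ((v : (quasiSplit (↥(maximalRealSubfield L)) L (IsCMField.complexConj L) 2).Adelic) * g)) ∂ν) * ((borelHeight g : ℝ) : ℂ) ^ (z'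 - 1)) (k : (quasiSplit (↥(maximalRealSubfield L)) L (IsCMField.complexConj L) 2).Adelic)) ∂μK) := inner_eq_integral_mul_conj (ψ' z') φK (hψ' z' hz' h1) hφK
  have hP3 : ⟪φK', ψ z⟫_ℂ = (∫ k, (fun g : (quasiSplit (↥(maximalRealSubfield L)) L (IsCMField.complexConj L) 2).Adelic => (∫ v : ↥(adelicUnipotent (↥(maximalRealSubfield L)) L (IsCMField.complexConj L) 2), flatSectionU φ z ((quasiSplit (↥(maximalRealSubfield L)) L (IsCMField.complexConj L) 2).toAdelic (weylLongU ((IsCMField.complexConj L : L ≃ₐ[↥(maximalRealSubfield L)] L) : L →+* L) (rfl : (StdForm.antidiagonal 2).over L = (StdForm.antidiagonal 2).over L)) * ((v : (quasiSplit (↥(maximalRealSubfield L)) L (IsCMField.complexConj L) 2).Adelic) * g)) ∂ν) * ((borelHeight g : ℝ) : ℂ) ^ (z - 1)) (k : (quasiSplit (↥(maximalRealSubfield L)) L (IsCMField.complexConj L) 2).Adelic) * conj (φ' (k : (quasiSplit (↥(maximalRealSubfield L)) L (IsCMField.complexConj L) 2).Adelic)) ∂μK) := inner_eq_integral_mul_conj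 φK' (ψ z) hφK' (hψ z hz (h1.trans h2))
  have hP4 : ⟪ψ' z', ψ z⟫_ℂ = (∫ k, (fun g : (quasiSplit (↥(maximalRealSubfield L)) L (IsCMField.complexConj L) 2).Adelic => (∫ v : ↥(adelicUnipotent (↥(maximalRealSubfield L)) L (IsCMField.complexConj L) 2), flatSectionU φ z ((quasiSplit (↥(maximalRealSubfield L)) L (IsCMField.complexConj L) 2).toAdelic (weylLongU ((IsCMField.complexConj L : L ≃ₐ[↥(maximalRealSubfield L)] L) : L →+* L) (rfl : (StdForm.antidiagonal 2).over L = (StdForm.antidiagonal 2).over L)) * ((v : (quasiSplit (↥(maximalRealSubfield L)) L (IsCMField.complexConj L) 2).Adelic) * g)) ∂ν) * ((borelHeight g : ℝ) : ℂ) ^ (z - 1)) (k : (quasiSplit (↥(maximalRealSubfield L)) L (IsCMField.complexConj L) 2).Adelic) * conj ((fun g : (quasiSplit (↥(maximalRealSubfield L)) L (IsCMField.complexConj L) 2).Adelic => (∫ v : ↥(adelicUnipotent (↥(maximalRealSubfield L)) L (IsCMField.complexConj L) 2), flatSectionU φ' z' ((quasiSplit (↥(maximalRealSubfield L)) L (IsCMField.complexConj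 L) 2).toAdelic (weylLongU ((IsCMField.complexConj L : L ≃ₐ[↥(maximalRealSubfield L)] L) : L →+* L) (rfl : (StdForm.antidiagonal 2).over L = (StdForm.antidiagonal 2).over L)) * ((v : (quasiSplit (↥(maximalRealSubfield L)) L (IsCMField.complexConj L) 2).Adelic) * g)) ∂ν) * ((borelHeight g : ℝ) : ℂ) ^ (z' - 1)) (k : (quasiSplit (↥(maximalRealSubfield L)) L (IsCMField.complexConj L) 2).Adelic)) ∂μK) := inner_eq_integral_mul_conj (ψ' z') (ψ z) (hψ' z' hz' h1) (hψ z hz (h1.trans h2))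
  simp only [hd, hd', one_mul, integral_mul_const, hκ, ← hP1, ← hP2, ← hP3, ← hP4, Complex.ofReal_one]

end Family

end Summit.HodgeConjecture.HodgeConjecture.Cruxes.H413.K2E1ChiMaassSelbergPairingModelCMTwo

end
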